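import Mathlib
import Summits.AtomisticToContinuum.Crystallization.Theses.ChartedPlanarOrder
import Summits.AtomisticToContinuum.Crystallization.Theorems.ChartedPlanarOrderLayeredSets
import Literature.MathematicalPhysics.StatisticalMechanics.LocalMatchingCompactness

/-!
# `stub_layeredHullPoint` (line `nnf-door` of crux `ChartedPlanarOrder.CleanBallPlanarOrder`, stmt-32136) — PROOF

decomp-a2c · lens-3 · g7.  A local-matching limit of `a`-scale layered Barlow windows
`S(A, a, s, z) = A {i u + j v + haggLabel s m · w + z m · e₃}` (Hägg letters `s`, layer heights `z` with gaps in
`[39a/50, 17a/20]`), two-way matched with translates of `x N` frequently in `N`, is a `39a/50`-separated, `2a`-dense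
hull point `X` of the sequence with two EXACT in-plane periods `t₁ = B u`, `t₂ = B v` (`B` a limit isometry):
`‖t₁‖ = ‖t₂‖ = a`, `‖t₂ - σ t₁‖ ≥ (√3/2) a ≥ 39a/50`.

Proof: diagonal choice of windows (radius `n`, tolerance `1/(n+1)`); pointwise-convergent subsequence of the
isometries (`A ↦ B`, compactness of the unit ball of `ℝ³ →L ℝ³`); compactness of uniformly discrete sets in the
local matching topology (`Literature…LocalMatchingCompactness`, [BaakeGrimm2013, Rem. 5.6]); the
layered sets are `min(a, 39a/50)`-separated (same layer: triangular lattice, `le_dist_barlowPos_of_ne`; different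
layers: third coordinate), `37a/20`-dense (layer selection by `Int.exists_greatest_of_bdd`, in-plane rounding) and
invariant under `± A u`, `± A v`; the periods pass to the limit because a uniformly discrete set contains every point
it approximates arbitrarily well (`mem_of_forall_near`).  0 sorry. [folklore]
-/

noncomputable section

namespace Summit.AtomisticToContinuum.Crystallization.Theorems.ChartedPlanarOrderLayeredHullPoint



open Filter Topology Metric
open Literature.MathematicalPhysics.StatisticalMechanics

local notation "E3" => EuclideanSpace ℝ (Fin 3)

/-! ## Isometries of `ℝ³` are sequentially compact (pointwise form)
(the pointwise statement of `SlackRigidityLawCongruence.exists_tendsto_linearIsometry`, whose module is not importable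
on the farm today — unbuilt `SlackRigidity.Negative.WitnessBasics`; its 10-line proof is repeated). -/

/-- Sequential compactness of the linear isometries of `ℝ³`: along a subsequence, pointwise convergence to a linear
isometry. [folklore] -/
theorem exists_strictMono_tendsto_linearIsometry (A : ℕ → E3 →ₗᵢ[ℝ] E3) :
    ∃ (φ : ℕ → ℕ) (B : E3 →ₗᵢ[ℝ] E3), StrictMono φ ∧
      ∀ p : E3, Tendsto (fun j => A (φ j) p) atTop (𝓝 (B p)) := by
  have hmem : ∀ n, (A n).toContinuousLinearMap ∈ Metric.closedBall (0 : E3 →L[ℝ] E3) 1 :=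
    fun n => mem_closedBall_zero_iff.2 (A n).norm_toContinuousLinearMap_le
  obtain ⟨T, -, φ, hφ, hlim⟩ :=
    (isCompact_closedBall (0 : E3 →L[ℝ] E3) 1).tendsto_subseq hmem
  have hpt : ∀ p : E3, Tendsto (fun j => A (φ j) p) atTop (𝓝 (T p)) := fun p => by
    have h := ((continuous_eval_const p).tendsto T).comp hlim
    simpa [Function.comp_def] using h
  have hT : ∀ x : E3, ‖T x‖ = ‖x‖ := fun x => by
    refine tendsto_nhds_unique (hpt x).norm ?_
    simp only [LinearIsometry.norm_map]
    exact tendsto_const_nhds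
  exact ⟨φ, ⟨(T : E3 →ₗ[ℝ] E3), hT⟩, hφ, hpt⟩

/-- A uniformly discrete set contains every point it approximates arbitrarily well. -/
theorem mem_of_forall_near {Y : Set E3} {δ : ℝ} (hδ : 0 < δ)
    (hsep : ∀ p ∈ Y, ∀ q ∈ Y, p ≠ q → δ ≤ dist p q) {q : E3}
    (h : ∀ ε : ℝ, 0 < ε → ∃ y ∈ Y, dist y q ≤ ε) : q ∈ Y := by
  obtain ⟨y₀, hy₀, hd₀⟩ := h (δ / 3) (by positivity)
  suffices y₀ = q by rwa [← this]
  by_contra hne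
  have hpos : 0 < dist y₀ q := dist_pos.2 hne
  obtain ⟨y, hy, hd⟩ := h (min (δ / 3) (dist y₀ q / 2)) (by positivity)
  have hd1 : dist y q ≤ δ / 3 := hd.trans (min_le_left _ _)
  have hd2 : dist y q ≤ dist y₀ q / 2 := hd.trans (min_le_right _ _)
  by_cases hyy : y₀ = y
  · subst hyy; linarith
  · have := hsep y₀ hy₀ y hy hyy
    have : dist y₀ y ≤ dist y₀ q + dist y q := dist_triangle_right _ _ _
    linarith

/-! ## The stub -/

/-- **`stub_layeredHullPoint`** (registered on stmt-AtomisticToContinuum-32136, line `nnf-door`), statement verbatim. -/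
theorem stub_layeredHullPoint : ∀ x : (N : ℕ) → (Fin N → EuclideanSpace ℝ (Fin 3)), ∀ a : ℝ, 47 / 50 ≤ a → a ≤ 1 → (∀ R ε : ℝ, 0 < ε → ∃ᶠ N in Filter.atTop, ∃ (A : EuclideanSpace ℝ (Fin 3) →ₗᵢ[ℝ] EuclideanSpace ℝ (Fin 3)) (t : EuclideanSpace ℝ (Fin 3)) (s : ℤ → ℤ) (z : ℤ → ℝ), Literature.MathematicalPhysics.StatisticalMechanics.IsHaggSeq s ∧ (∀ m : ℤ, 39 / 50 * a ≤ z (m + 1) - z m ∧ z (m + 1) - z m ≤ 17 / 20 * a) ∧ let S : Set (EuclideanSpace ℝ (Fin 3)) := {p | ∃ m i j : ℤ, p = A ((((i : ℝ) • Literature.MathematicalPhysics.StatisticalMechanics.triangularVec₁ a) + ((j : ℝ) • Literature.MathematicalPhysics.StatisticalMechanics.triangularVec₂ a) + ((Literature.MathematicalPhysics.StatisticalMechanics.haggLabel s m : ℝ) • Literature.MathematicalPhysics.StatisticalMechanics.barlowOffset a) + (z m • Literature.MathematicalPhysics.StatisticalMechanics.layerNormal 1)))}; (∀ p ∈ S,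 ‖p‖ ≤ R → ∃ i : Fin N, dist (x N i + t) p ≤ ε) ∧ (∀ i : Fin N, ‖x N i + t‖ ≤ R → ∃ p ∈ S, dist (x N i + t) p ≤ ε)) → ∃ X : Set (EuclideanSpace ℝ (Fin 3)), ∃ t₁ t₂ : EuclideanSpace ℝ (Fin 3), (∀ p ∈ X, ∀ q ∈ X, p ≠ q → 39 / 50 * a ≤ dist p q) ∧ (∀ c : EuclideanSpace ℝ (Fin 3), ∃ p ∈ X, dist p c ≤ 2 * a) ∧ (∀ R ε : ℝ, 0 < ε → ∃ᶠ N in Filter.atTop, ∃ t : EuclideanSpace ℝ (Fin 3), (∀ p ∈ X, ‖p‖ ≤ R → ∃ i : Fin N, dist (x N i + t) p ≤ ε) ∧ (∀ i : Fin N, ‖x N i + t‖ ≤ R → ∃ p ∈ X, dist (x N i + t) p ≤ ε)) ∧ ‖t₁‖ = a ∧ ‖t₂‖ = a ∧ (∀ s : ℝ, 39 / 50 * a ≤ ‖t₂ - s • t₁‖) ∧ (∀ p ∈ X, p + t₁ ∈ X ∧ p - t₁ ∈ X ∧ p + t₂ ∈ X ∧ p - t₂ ∈ X) := by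
  intro x a ha₁ ha₂ hW
  have ha : 0 < a := by linarith
  -- read the `let` through an explicit set
  have hW' : ∀ R ε : ℝ, 0 < ε → ∃ᶠ N in atTop, ∃ (A : E3 →ₗᵢ[ℝ] E3) (t : E3) (s : ℤ → ℤ) (z : ℤ → ℝ),
      IsHaggSeq s ∧ (∀ m : ℤ, 39 / 50 * a ≤ z (m + 1) - z m ∧ z (m + 1) - z m ≤ 17 / 20 * a) ∧
      (∀ p ∈ {p : E3 | ∃ m i j : ℤ, p = A ((((i : ℝ) • triangularVec₁ a) + ((j : ℝ) • triangularVec₂ a) +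
        ((haggLabel s m : ℝ) • barlowOffset a) + (z m • layerNormal 1)))},
        ‖p‖ ≤ R → ∃ i : Fin N, dist (x N i + t) p ≤ ε) ∧
      (∀ i : Fin N, ‖x N i + t‖ ≤ R → ∃ p ∈ {p : E3 | ∃ m i j : ℤ, p = A ((((i : ℝ) • triangularVec₁ a) +
        ((j : ℝ) • triangularVec₂ a) + ((haggLabel s m : ℝ) • barlowOffset a) + (z m • layerNormal 1)))},
        dist (x N i + t) p ≤ ε) := by
    intro R ε hε
    refine (hW R ε hε).mono ?_
    rintro N ⟨A, t, s, z, hs, hz, hm⟩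
    exact ⟨A, t, s, z, hs, hz, hm.1, hm.2⟩
  -- diagonal choice of windows: radius `n`, tolerance `1/(n+1)`
  obtain ⟨φ, hφ, hwin⟩ := extraction_forall_of_frequently
    (fun n : ℕ => hW' n (1 / ((n : ℝ) + 1)) (by positivity))
  choose A t s z hs hz hm₁ hm₂ using hwin
  -- convergent subsequence of the isometries
  obtain ⟨θ, B, hθ, hB⟩ := exists_strictMono_tendsto_linearIsometry A
  -- the layered sets along `θ`, uniformly discrete
  set Ys : ℕ → Set E3 := fun n => {p : E3 | ∃ m i j : ℤ, p = A (θ n) ((((i : ℝ) • triangularVec₁ a) +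
    ((j : ℝ) • triangularVec₂ a) + ((haggLabel (s (θ n)) m : ℝ) • barlowOffset a) + (z (θ n) m • layerNormal 1)))}
    with hYs
  have hδ₀ : (0 : ℝ) < 39 / 50 * a := by positivity
  have hYsep : ∀ n, ∀ p ∈ Ys n, ∀ q ∈ Ys n, p ≠ q → 39 / 50 * a ≤ dist p q :=
    fun n => layered_sep ha.le (fun m => (hz (θ n) m).1) rfl
  -- compactness in the local matching topology
  obtain ⟨ψ, Y, hψ, hYsep', hmatch⟩ := exists_subseq_forall_eventually_ballMatch hδ₀ Ys hYsep
  have hn_tend : Tendsto (fun k => θ (ψ k)) atTop atTop := hθ.tendsto_atTop.comp hψ.tendsto_atTop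
  refine ⟨Y, B (triangularVec₁ a), B (triangularVec₂ a), hYsep', fun c => ?_, fun R ε hε => ?_,
    by rw [B.norm_map, (norms_generators ha.le).1], by rw [B.norm_map, (norms_generators ha.le).2.1],
    fun σ => ?_, fun p hp => ?_⟩
  · -- relative denseness `2a`
    obtain ⟨k, hk⟩ := (hmatch (‖c‖ + 37 / 20 * a) (a / 10) (by positivity)).exists
    obtain ⟨p, hp, hpc⟩ := layered_dense (A := A (θ (ψ k))) ha (s := s (θ (ψ k))) (hz (θ (ψ k))) rfl c
    have hpR : dist p 0 ≤ ‖c‖ + 37 / 20 * a := by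
      rw [dist_zero_right]
      have := norm_le_norm_add_norm_sub' p c
      rw [← dist_eq_norm] at this
      linarith
    obtain ⟨y, hy, hpy⟩ := hk.2 p hp hpR
    refine ⟨y, hy, ?_⟩
    calc dist y c ≤ dist p y + dist p c := dist_triangle_left _ _ _
      _ ≤ a / 10 + 37 / 20 * a := by linarith
      _ ≤ 2 * a := by linarith
  · -- hull property along `N_k = φ (θ (ψ k))`
    have hT : Tendsto (fun k => φ (θ (ψ k))) atTop atTop := hφ.tendsto_atTop.comp hn_tend
    obtain ⟨n₁, hn₁⟩ := exists_nat_ge (max (R + ε) (2 / ε))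
    have hev := (hmatch (R + ε) (ε / 2) (by positivity)).and (hn_tend.eventually (eventually_ge_atTop n₁))
    refine hT.frequently (hev.mono fun k hk => ?_).frequently
    obtain ⟨hk, hkn⟩ := hk
    set n := θ (ψ k) with hn
    have hnR : R + ε ≤ (n : ℝ) := by
      have : (n₁ : ℝ) ≤ n := by exact_mod_cast hkn
      linarith [le_max_left (R + ε) (2 / ε)]
    have hnε : 1 / ((n : ℝ) + 1) ≤ ε / 2 := by
      have h2 : 2 / ε ≤ (n : ℝ) := by
        have : (n₁ : ℝ) ≤ n := by exact_mod_cast hkn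
        linarith [le_max_right (R + ε) (2 / ε)]
      rw [div_le_iff₀ (by positivity)]
      rw [div_le_iff₀ hε] at h2
      nlinarith
    refine ⟨t n, fun p hp hpR => ?_, fun i hiR => ?_⟩
    · obtain ⟨q, hq, hqp⟩ := hk.1 p hp (by rw [dist_zero_right]; linarith)
      have hqR : ‖q‖ ≤ (n : ℝ) := by
        have := norm_le_norm_add_norm_sub' q p
        rw [← dist_eq_norm] at this
        linarith
      obtain ⟨i, hi⟩ := hm₁ n q hq hqR
      exact ⟨i, by linarith [dist_triangle (x (φ n) i + t n) q p]⟩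
    · have hiR' : ‖x (φ n) i + t n‖ ≤ (n : ℝ) := by linarith
      obtain ⟨q, hq, hiq⟩ := hm₂ n i hiR'
      have hqR : dist q 0 ≤ R + ε := by
        rw [dist_zero_right]
        have := norm_le_norm_add_norm_sub' q (x (φ n) i + t n)
        rw [← dist_eq_norm, dist_comm] at this
        linarith
      obtain ⟨y, hy, hqy⟩ := hk.2 q hq hqR
      exact ⟨y, hy, by linarith [dist_triangle (x (φ n) i + t n) q y]⟩
  · -- linear independence bound
    rw [← B.map_smul, ← B.map_sub, B.norm_map]
    exact norm_triangularVec₂_sub_smul ha.le σ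
  · -- exact periods of the limit
    have key : ∀ v : E3, ‖v‖ ≤ a → (∀ n, ∀ q ∈ Ys n, q + A (θ n) v ∈ Ys n) → p + B v ∈ Y := by
      intro v hv hinv
      refine mem_of_forall_near hδ₀ hYsep' fun ε hε => ?_
      have hBv : Tendsto (fun k => A (θ (ψ k)) v) atTop (𝓝 (B v)) := (hB v).comp hψ.tendsto_atTop
      have hev := (hmatch (‖p‖ + a + ε) (ε / 3) (by positivity)).and
        ((Metric.tendsto_nhds.1 hBv) (ε / 3) (by positivity))
      obtain ⟨k, hk, hkv⟩ := hev.exists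
      obtain ⟨q, hq, hqp⟩ := hk.1 p hp (by rw [dist_zero_right]; linarith)
      have hq' := hinv (ψ k) q hq
      have hq'R : dist (q + A (θ (ψ k)) v) 0 ≤ ‖p‖ + a + ε := by
        rw [dist_zero_right]
        have h1 := norm_le_norm_add_norm_sub' q p
        rw [← dist_eq_norm] at h1
        have h2 : ‖q + A (θ (ψ k)) v‖ ≤ ‖q‖ + ‖A (θ (ψ k)) v‖ := norm_add_le _ _
        rw [LinearIsometry.norm_map] at h2
        linarith
      obtain ⟨y, hy, hqy⟩ := hk.2 _ hq' hq'R
      refine ⟨y, hy, ?_⟩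
      have h3 : dist (q + A (θ (ψ k)) v) (p + B v) ≤ dist q p + dist (A (θ (ψ k)) v) (B v) :=
        dist_add_add_le _ _ _ _
      have h4 : dist (A (θ (ψ k)) v) (B v) < ε / 3 := hkv
      calc dist y (p + B v) ≤ dist (q + A (θ (ψ k)) v) y + dist (q + A (θ (ψ k)) v) (p + B v) :=
            dist_triangle_left _ _ _
        _ ≤ ε / 3 + (ε / 3 + ε / 3) := by linarith
        _ = ε := by ring
    have hv₁ : ‖triangularVec₁ a‖ ≤ a := (norms_generators ha.le).1.le
    have hv₂ : ‖triangularVec₂ a‖ ≤ a := (norms_generators ha.le).2.1.le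
    refine ⟨key _ hv₁ fun n q hq => (layered_periods rfl hq).1, ?_, key _ hv₂ fun n q hq => (layered_periods rfl hq).2.2.1, ?_⟩
    · have h := key (-triangularVec₁ a) (by rwa [norm_neg]) fun n q hq => by
        rw [LinearIsometry.map_neg, ← sub_eq_add_neg]
        exact (layered_periods rfl hq).2.1
      rw [LinearIsometry.map_neg, ← sub_eq_add_neg] at h
      exact h
    · have h := key (-triangularVec₂ a) (by rwa [norm_neg]) fun n q hq => by
        rw [LinearIsometry.map_neg, ← sub_eq_add_neg]
        exact (layered_periods rfl hq).2.2.2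
      rw [LinearIsometry.map_neg, ← sub_eq_add_neg] at h
      exact h

end Summit.AtomisticToContinuum.Crystallization.Theorems.ChartedPlanarOrderLayeredHullPoint

end
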